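import Summits.BirchSwinnertonDyer.BirchSwinnertonDyer.Theses.SignedLowerHalves
import Summits.BirchSwinnertonDyer.BirchSwinnertonDyer.Theorems.SignedLowerHalvesSmallImageLowerHalfBothSignsLambdaLowerThreeNsThetaTransportThree
import HarnessLib

/-!
# Route `SignedLowerHalves`, crux L `SmallImageLowerHalfBothSigns` (item stmt-BirchSwinnertonDyer-23599) BY NAME from
# print ∧ the one-sign analytic floor at `p ≥ 5` (= line `birth_acns` v15's `stub_muOneSign_ns_ge5`, VERBATIM) ∧ the
# three LEVEL-MATCHED residual-theta-transport statements K0₂ / Kan₂ / Kλ₂ at every odd `p` — part 4 of the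
# `p`-twin series of route `ResidualThetaTransportAtTwo` (cell `bsd-ssimc`, width seat `bsd-line-slh-p3-w3` gen 8;
# BY-NAME helper, `--supports stmt-BirchSwinnertonDyer-23599 --as helper`; THEOREMS ONLY; closes nothing; BSD NOT proved)

HONEST FRAMING. A sorry-free SKELETON-SHAPED theorem, not a proof of crux L: the conclusion is the route decl
`Theses.SignedLowerHalves.SmallImageLowerHalfBothSigns` BY NAME, the hypotheses are DISPLAYED — the published facts
`hJ h12 h41 h5 h3`, the one-sign analytic `μ`-floor at `5 ≤ p` in the exact words of line `birth_acns` v15's stub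
`stub_muOneSign_ns_ge5` (= retired item 23117; conjecture-grade, Pollack 2003 Conj. 6.3 for one sign), and the
LEVEL-MATCHED `p`-twins K0₂ / Kan₂ / Kλ₂ of route `ResidualThetaTransportAtTwo`'s items K0⁺ (20690) / Kan⁺ (20688) /
Kλ⁺ (20787) (part 3; carry clause (C-S6/S7) of ARM-P sheet U-r02-AP in the `max 2` form), universally quantified over
crux L's domain at every odd `p` (each print-composite at odd `p` — 0 GAP on the reader's sheet — and NOT typed). What
it shows (D-0014): crux L admits an ENGINE-FREE, PREPRINT-FREE decomposition {23117 at `p ≥ 5`, K0₂, Kan₂, Kλ₂} ∪ print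
(the proposed second line `Lines/rtt_w3.lean`), versus line `birth_acns` v15's {23117, `stub_ES2rat_ns`,
`stub_acDivRat_ns`, `stub_preprintInputs_ns`, `stub_lambdaLowerThree_ns`} ∪ print; at `p = 3` no floor is displayed
(THEOREM B, inside part 1). Mechanism: `p = 3` ⟹ part 1 §3 + part 3 §8; `5 ≤ p` ⟹ part 3 §8; then the sign is idle on
X7 (`SignDefect.X7.exists_kobayashiLowerDivisibility_iff_forall`, joint package `hJ`). Memo: crux dir
`Lines/birth_acns-MEMO-w3-g8.md`.

References: [Kobayashi2003] Conjecture (p. 2), Thm. 1.2, Thm. 4.1, Thm. 7.4; [PollackWeston2011MT] §2–§3, Thm. 4.1,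
Rem. 4.2; [Pollack2003] Conj. 6.3, Prop. 6.18; [Vatsal1999] §1 (1.6), Thm. (1.13); [GreenbergVatsal2000] §1 (8)–(10),
Prop. (2.8), Thm. (1.4); [HatleyLei2019] Thm. 4.6; [BDKim2009] Cor. 2.13; [PollackRubin2004] Theorem (p. 448).
-/

set_option autoImplicit false
-- D-0017: single-problem summit, the namespace repeats the problem name by design.
set_option linter.dupNamespace false
noncomputable section

open scoped Classical MatrixGroups ModularForm BigOperators

open CongruenceSubgroup WeierstrassCurve Field Polynomial NumberField IsDedekindDomain
  Literature.NumberTheory.EllipticCurves Literature.NumberTheory.EllipticCurves.ModularForms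
  Literature.NumberTheory.EllipticCurves.Rank1Residual
  Literature.NumberTheory.EllipticCurves.Kobayashi2003
  Literature.NumberTheory.EllipticCurves.GreenbergVatsal2000 ZpExtension
  Literature.NumberTheory.IwasawaTheory Rat.HeightOneSpectrum
  Summit.BirchSwinnertonDyer.Rank1Residual.Supersingular
  Summit.BirchSwinnertonDyer.Rank1Residual.X1.MuLambda

namespace Summit.BirchSwinnertonDyer.BirchSwinnertonDyer.Theorems.SmallImageLambdaLowerThreeNsThetaTransport

/-- **Crux L `SmallImageLowerHalfBothSigns` BY NAME ⟸ print ∧ (one-sign floor at `p ≥ 5` = `stub_muOneSign_ns_ge5`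
VERBATIM) ∧ K0₂@p ∧ Kan₂@p ∧ Kλ₂@p at every odd `p` on the domain.** Displayed: `hJ`, `h12`, `h41` (rational clause),
`h5`/`h3`; `hfloor5` = line `birth_acns` v15's `stub_muOneSign_ns_ge5` text (= retired 23117; conjecture-grade);
`hK0` / `hKan` / `hKlam` = the LEVEL-MATCHED `p`-twins of route `ResidualThetaTransportAtTwo`'s K0⁺ / Kan⁺ / Kλ⁺
(print-composite at odd `p`, parts 2–3). `p = 3`: part 1 `forall_kobayashiLowerDivisibility_three_of_lamTransport`
(floor = THEOREM B) + part 3 `lamTransport_of_rtt_levelMatched`; `5 ≤ p`: part 3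
`exists_kobayashiMainConjecture_of_oneSignFloor_of_rtt_levelMatched` + sign idleness. A sorry-free line-shaped
decomposition; CONDITIONAL; closes nothing; crux L / BSD NOT proved.
[cite: Kobayashi2003, Conjecture (p. 2), Thm. 7.4 (p. 13)] [cite: Pollack2003, Conj. 6.3] [cite: PollackWeston2011MT, §3.1, Thm. 4.1 (1)]
[cite: GreenbergVatsal2000, Thm. (1.4), §1 (8)–(10)] [cite: HatleyLei2019, Thm. 4.6] [cite: Vatsal1999, §1 (1.6), Thm. (1.13)] -/
theorem smallImageLowerHalfBothSigns_of_oneSignFloor_of_rtt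
    (hJ : thm62_63_73_signedColemanKato_zetaJoint) (h12 : thm12_signedSelmerDual_finite_torsion)
    (h41 : thm41_signedCharIdeal_divisibility)
    (h5 : realPeriodRat_eq_unit_mul_plusPeriod) (h3 : realPeriodRat_eq_unit_mul_plusPeriod_three)
    (hfloor5 : ∀ (W : WeierstrassCurve ℚ) [W.IsElliptic] [W.IsGloballyMinimal] (p : ℕ) [Fact p.Prime],
      5 ≤ p → ClassX7 W p → ¬ W.HasCM → W.frobeniusTrace p = 0 → ¬ Surj W p →
      ∀ [NeZero (W.conductorNorm ℤ)] (f : CuspForm (Gamma0 (W.conductorNorm ℤ)) 2),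
        IsNewformOf W f → ∃ (ε₀ : ℤˣ) (L₀ : IwasawaAlgebra p), IsSignedPAdicLFunction f p ε₀ L₀ ∧ HasUnitContent L₀)
    (hK0 : ∀ (W : WeierstrassCurve ℚ) [W.IsElliptic] [W.IsGloballyMinimal] (p : ℕ) [Fact p.Prime],
      p ≠ 2 → ClassX7 W p → ¬ W.HasCM → W.frobeniusTrace p = 0 → ¬ Surj W p →
      ∃ (M : ℕ) (_ : NeZero M) (g : CuspForm (Gamma0 M) 2) (ι : coeffField g →+* PadicAlgCl p) (Ω : ℂ),
        ¬ p ∣ M ∧ (∀ ℓ : ℕ, ℓ.Prime → ℓ ≠ p → max 2 (padicValNat ℓ M) = max 2 (padicValNat ℓ (W.conductorNorm ℤ))) ∧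
          IsNewform0 g ∧ Literature.NumberTheory.Automorphic.IsCMForm (liftToGamma1 M 2 g) ∧
          cuspCoeff g p = 0 ∧ IsCohomologicalPlusPeriod g ι Ω ∧
          (∀ ℓ : ℕ, ℓ.Prime → ¬ ℓ ∣ p * M * W.conductorNorm ℤ →
            ‖embCoeff g ι ℓ - (W.frobeniusTrace ℓ : PadicAlgCl p)‖ < 1))
    (hKan : ∀ (W : WeierstrassCurve ℚ) [W.IsElliptic] [W.IsGloballyMinimal] (p : ℕ) [Fact p.Prime],
      p ≠ 2 → ClassX7 W p → ¬ W.HasCM → W.frobeniusTrace p = 0 → ¬ Surj W p →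
      ∀ (ε : ℤˣ), ∀ (M : ℕ) [NeZero M] (g : CuspForm (Gamma0 M) 2) (ι : coeffField g →+* PadicAlgCl p) (Ω : ℂ),
        ¬ p ∣ M → (∀ ℓ : ℕ, ℓ.Prime → ℓ ≠ p → max 2 (padicValNat ℓ M) = max 2 (padicValNat ℓ (W.conductorNorm ℤ))) →
        IsNewform0 g → Literature.NumberTheory.Automorphic.IsCMForm (liftToGamma1 M 2 g) →
        cuspCoeff g p = 0 → IsPlusPeriod g Ω →
        (∀ ℓ : ℕ, ℓ.Prime → ¬ ℓ ∣ p * M * W.conductorNorm ℤ →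
          ‖embCoeff g ι ℓ - (W.frobeniusTrace ℓ : PadicAlgCl p)‖ < 1) →
        ∀ [NeZero (W.conductorNorm ℤ)] (f : CuspForm (Gamma0 (W.conductorNorm ℤ)) 2), IsNewformOf W f →
        ∀ (Lplus Lminus : IwasawaAlgebra p), IsPollackPair f p Lplus Lminus →
          HasUnitContent (kobayashiL ε Lplus Lminus) →
        ∀ (S₀ : Finset (HeightOneSpectrum (𝓞 ℚ))), (∀ v ∈ S₀, ((p : ℕ) : 𝓞 ℚ) ∉ v.asIdeal) →
          (∀ v : HeightOneSpectrum (𝓞 ℚ), ¬ W.HasGoodReductionAt v → v ∈ S₀) →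
          (∀ v : HeightOneSpectrum (𝓞 ℚ), natGenerator v ∣ M → v ∈ S₀) →
        ∃ n₀ : ℕ, ∀ n ≥ n₀, (Even n ↔ ε = 1) →
          layerLambda (((mazurTateElement f p n).map (algebraMap ℚ (PadicAlgCl p)) *
              ∏ v ∈ S₀, ((W.localPolynomialAt v).map (Int.castRingHom (PadicAlgCl p))).comp
                (C ((natGenerator v : PadicAlgCl p)⁻¹) *
                  (X + 1) ^ (PadicInt.toZModPow n (-(frobeniusExponent p (natGenerator v : ℤ_[p])))).val)) %ₘ
              ((X + 1) ^ p ^ n - 1)) =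
          layerLambda (((mazurTateElementK g Ω p n).map ι *
              ∏ v ∈ S₀, (1 - C (embCoeff g ι (natGenerator v)) * X +
                  (if natGenerator v ∣ M then 0 else C (natGenerator v : PadicAlgCl p)) * X ^ 2).comp
                (C ((natGenerator v : PadicAlgCl p)⁻¹) *
                  (X + 1) ^ (PadicInt.toZModPow n (-(frobeniusExponent p (natGenerator v : ℤ_[p])))).val)) %ₘ
              ((X + 1) ^ p ^ n - 1)))
    (hKlam : ∀ (W : WeierstrassCurve ℚ) [W.IsElliptic] [W.IsGloballyMinimal] (p : ℕ) [Fact p.Prime],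
      p ≠ 2 → ClassX7 W p → ¬ W.HasCM → W.frobeniusTrace p = 0 → ¬ Surj W p →
      ∀ (ε : ℤˣ), ∀ (M : ℕ) [NeZero M] (g : CuspForm (Gamma0 M) 2) (ι : coeffField g →+* PadicAlgCl p) (Ω : ℂ),
        ¬ p ∣ M → (∀ ℓ : ℕ, ℓ.Prime → ℓ ≠ p → max 2 (padicValNat ℓ M) = max 2 (padicValNat ℓ (W.conductorNorm ℤ))) →
        IsNewform0 g → Literature.NumberTheory.Automorphic.IsCMForm (liftToGamma1 M 2 g) →
        cuspCoeff g p = 0 → IsPlusPeriod g Ω →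
        (∀ ℓ : ℕ, ℓ.Prime → ¬ ℓ ∣ p * M * W.conductorNorm ℤ →
          ‖embCoeff g ι ℓ - (W.frobeniusTrace ℓ : PadicAlgCl p)‖ < 1) →
        ∀ (κ : ZpExtension ℚ p) (γ : absoluteGaloisGroup ℚ),
          κ.IsCyclotomic → κ.IsTopGenerator γ → IsCyclotomicVariable p γ →
        ∀ [NeZero (W.conductorNorm ℤ)] (f : CuspForm (Gamma0 (W.conductorNorm ℤ)) 2), IsNewformOf W f →
        ∀ (ϖ : ℚ), (ϖ : ℝ) * W.realPeriodRat = plusPeriod f →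
        ∀ (Lplus Lminus : IwasawaAlgebra p), IsPollackPair f p Lplus Lminus →
        ∀ (S₀ : Finset (HeightOneSpectrum (𝓞 ℚ))), (∀ v ∈ S₀, ((p : ℕ) : 𝓞 ℚ) ∉ v.asIdeal) →
          (∀ v : HeightOneSpectrum (𝓞 ℚ), ¬ W.HasGoodReductionAt v → v ∈ S₀) →
          (∀ v : HeightOneSpectrum (𝓞 ℚ), natGenerator v ∣ M → v ∈ S₀) →
        ∀ (D : SignedSelmerDualData W κ γ ε) [Module.Finite (IwasawaAlgebra p) D.X],
          Module.IsTorsion (IwasawaAlgebra p) D.X → D.mu = 0 →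
        ∀ (G : IwasawaAlgebra p) (m : ℕ),
          iwasawaToPowerSeries p G =
            PowerSeries.C ((p : ℚ_[p]) ^ m * (ϖ : ℚ_[p])) * iwasawaToPowerSeries p (kobayashiL ε Lplus Lminus) →
        ∃ n₀ : ℕ, ∀ n ≥ n₀, (Even n ↔ ε = 1) →
          ((lambdaInvariant p D.X : ℕ) : ℤ) - ((lam G : ℕ) : ℤ) =
            ((layerLambda (((mazurTateElementK g Ω p n).map ι *
              ∏ v ∈ S₀, (1 - C (embCoeff g ι (natGenerator v)) * X +
                  (if natGenerator v ∣ M then 0 else C (natGenerator v : PadicAlgCl p)) * X ^ 2).comp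
                (C ((natGenerator v : PadicAlgCl p)⁻¹) *
                  (X + 1) ^ (PadicInt.toZModPow n (-(frobeniusExponent p (natGenerator v : ℤ_[p])))).val)) %ₘ
              ((X + 1) ^ p ^ n - 1)) : ℕ) : ℤ) -
            ((layerLambda (((mazurTateElement f p n).map (algebraMap ℚ (PadicAlgCl p)) *
              ∏ v ∈ S₀, ((W.localPolynomialAt v).map (Int.castRingHom (PadicAlgCl p))).comp
                (C ((natGenerator v : PadicAlgCl p)⁻¹) *
                  (X + 1) ^ (PadicInt.toZModPow n (-(frobeniusExponent p (natGenerator v : ℤ_[p])))).val)) %ₘ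
              ((X + 1) ^ p ^ n - 1)) : ℕ) : ℤ)) :
    Summit.BirchSwinnertonDyer.BirchSwinnertonDyer.Theses.SignedLowerHalves.SmallImageLowerHalfBothSigns := by
  intro W _ _ p _ hp2 hX hCM hap hs ε
  by_cases hp3 : p = 3
  · exact forall_kobayashiLowerDivisibility_three_of_lamTransport W p hp3 hJ h12 h41 h5 h3 hX hap hs
      (fun ε' κ γ hκ hγ hγ' _ f hf ϖ hϖ Lplus Lminus hPP hfl D _ hXt hμ G m hG ↦
        lamTransport_of_rtt_levelMatched W p hX.1.1 ε' (hK0 W p hp2 hX hCM hap hs) (hKan W p hp2 hX hCM hap hs ε')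
          (hKlam W p hp2 hX hCM hap hs ε') κ γ hκ hγ hγ' f hf ϖ hϖ Lplus Lminus hPP hfl D hXt hμ G m hG) ε
  · have hp5 : 5 ≤ p := by
      have h2 := (Fact.out : p.Prime).two_le
      by_contra h
      interval_cases p
      · exact hp2 rfl
      · exact hp3 rfl
      · exact absurd (Fact.out : Nat.Prime 4) (by decide)
    obtain ⟨ε₀, hε₀⟩ := exists_kobayashiMainConjecture_of_oneSignFloor_of_rtt_levelMatched W p hp2
      (thm62_63_73_signedColemanKato_zeta_of_joint hJ) h12 h41 h5 h3 hX.1.1 hap hs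
      (fun f hf ↦ hfloor5 W p hp5 hX hCM hap hs f hf) (hK0 W p hp2 hX hCM hap hs) (hKan W p hp2 hX hCM hap hs)
      (hKlam W p hp2 hX hCM hap hs)
    exact (SignDefect.X7.exists_kobayashiLowerDivisibility_iff_forall W p h12 h5 h3 hJ hp2 hX hap).mp
      ⟨ε₀, kobayashiLowerDivisibility_of_mainConjecture hε₀⟩ ε

end Summit.BirchSwinnertonDyer.BirchSwinnertonDyer.Theorems.SmallImageLambdaLowerThreeNsThetaTransport

end
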